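import Literature.MathematicalPhysics.QuantumFieldTheory.Balaban1983to89.B9Thm311SmallFieldCoercivityTowerScaled
import Literature.MathematicalPhysics.QuantumFieldTheory.Balaban1983to89.B9Eq315QTowerLipschitzL2
import Literature.MathematicalPhysics.QuantumFieldTheory.Balaban1983to89.B9Eq315QTowerFlatNorm
import Literature.MathematicalPhysics.QuantumFieldTheory.Balaban1983to89.B9Eq384RemainderLetters

/-!
# `Balaban1983to89.B9Thm311SmallFieldCoercivityTowerDiagonal` — T. Bałaban, *Propagators for lattice gauge theories in a background field*, Commun.
# Math. Phys. **99** (1985) 389–434 [Balaban1985BackgroundPropagators] Thm 3.11 p. 416 with (3.15)–(3.16) p. 393, (3.35) p. 396, (3.82)–(3.86) p. 407;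
# [Balaban1984PropagatorsI] Prop. 1.1 (1.90) p. 33: **THE `k`-LEVEL STRONG SMALL-FIELD COERCIVITY OF THE PRINCIPAL GAUGE-FIXED OPERATOR
# `D*D + D R_k(U) D* + a Q_k(U)†Q_k(U)` ON PRINT's DIAGONAL `η = L^{−(n+1)}`, `c₁ = c₀L^{(n+1)d}`, WITH THE TRANSPORTER LETTER `K_R` AND BOTH
# `Q`-LETTERS `M_Q`, `C_Q` DISCHARGED — THE `k`-LEVEL `R`-LETTER `C_R` IS THE ONLY DISPLAY LEFT** (`B9Thm311SmallFieldCoercivityTowerScaled` +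
# NE9 leaf-02's volume-free `L²` tower letters `B9Eq315QTowerFlatNorm.norm_QkW_one_le_canonical`, `B9Eq315QTowerLipschitzL2.norm_QkW_sub_flat_le_L2_geometric`
# + `B9Eq384RemainderLetters.norm_adTransportW_sub_le`)

statement-level skeleton of published theorems with citation tags; proofs where landed; nothing here is a claim about the Yang–Mills mass gap

CITATION HEADER (lean-in-tree rule).  Audit cell `pub-balaban`, sub-cell `t4`, BINDER row NE9; filed by the row OWNER lineage `b2b-balaban-t4-ne9-p1`
(gen 85), INTENT I-ne9p1-g85-4, ADOPTING NE9 leaf-02 gen 64's located reading W-2 (journal 2026-08-22) of the lineage's `…TowerScaled`: its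
`M_Q`∕`C_Q` slots are inhabitable uniformly only on the diagonal ∕ a slab, since `‖Q_k(1)‖ = M_φ′M_φ(ηL^{n+1})⁻¹` exactly.  Sources READ by this
lineage in the held text `paper:balaban1985-cmp99-background-propagators` (journal page = PDF page + 388): pp. 393, 396, 407, 416.

THE PRINT (verbatim).  p. 416, Thm 3.11: *«Under the assumptions of the Theorems 3.1–3.10 (i.e. for M sufficiently large and α₀ sufficiently small) the
operators Δ′_a, G′, (Q′G′²Q′*)⁻¹, Δ_a, G are positive definite.»*; p. 393: the `k`-th step lives on the `η = L^{−k}` lattice with the weights (3.16)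
`(L^jη)^{d−2}`; p. 396, (3.35): the scaled small-field window.

WHY THIS FILE (cell context).  `B9Thm311SmallFieldCoercivityTowerScaled.exists_strong_coercive_of_scaled_letters_tower` (gen 84) has `∃ α₀ γ′` BEFORE
`∀ L n η (0 < ηL^{n+1} ≤ 1) c₀ c₁ m U` modulo FOUR displayed letters `(K_R, C_R, C_Q, M_Q)`.  Three of them are theorems of the tree on the DIAGONAL:
`K_R = 2M_φM_φ′` (transporters of an `αη`-small field), `M_Q = M_φ′M_φ` (leaf-02's flat count along (3.16)), `C_Q·α = M_φ′M_φ·(e^{Ξ(d,L)α∕(1−r)} − 1) ≤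
2M_φ′M_φΞα∕(1−r)` under the geometric bond-smallness profile `ε_j ≤ α r^j` (leaf-02's volume-free `ℓ²` telescoping; `Ξ(d,L) = L^{d∕2}√(2d)·102(d+1)²L`).
This file composes them: on the diagonal the `k`-level strong small-field coercivity holds with `∃ α₀ γ′` BEFORE `∀ n η c₀ c₁ m U α`, MODULO THE
`k`-LEVEL `R`-LETTER `C_R` ALONE — the one letter PRICING-NE9 v69 lists as not closed at the point (the owner's programme «ROUTE G one storey up»,
`B9Eq324DeltaPrimeATower` ff., is its cure).

WHAT IS PROVED (sorry-free; no `def`, no `Prop` placeholder; no inequality of the paper asserted).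
* §1 `exp_sub_one_le_two_mul` (`0 ≤ y ≤ 1 ⇒ e^y − 1 ≤ 2y`, Mathlib's `Real.abs_exp_sub_one_le`); `sqrt_ratio_diagonal` (`c₁ = c₀L^{kd} ⇒ √(c₁∕(c₀L^{kd})) = 1`).
* §2 **`strong_coercive_tower_diagonal`** — ONE lattice height `n`, on the diagonal `ηL^{n+1} = 1`, `c₀(L^{n+1})^d = c₁`, for a background `U` with
  unit-bounded `αη`-small bond variables, mutually adjoint transporters, per-level averaging data `(α_j ≤ 1∕64, U1, regularity)` and bond-smallness
  profile `ε_j ≤ α·r^j` (`0 ≤ r < 1`), the `R`-letter `‖(R_k(U) − R_k(1))y‖ ≤ C_Rα‖y‖` DISPLAYED, and `α ≤ 1`, `Ξα ≤ 1 − r`, `α ≤ γ(d,a)∕(2Θ♯+1)`: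
  `(γ(d,a)∕2)·(‖D(1)x‖² + ‖D*(1)x‖² + ‖x‖²) ≤ re⟨x, Δ^{(n+1)}_a(U)x⟩`, `γ(d,a) = 1∕((d+1)Cst d a)`,
  `Θ♯ = Θ(d, a, 2M_φM_φ′, C_R, 2M_φ′M_φΞ∕(1−r), M_φ′M_φ)` — `…TowerScaled.strong_coercive_of_scaled_letters_tower` with `hRε`, `hQ`, `hQ₁` DISCHARGED.
* §3 **`exists_strong_coercive_tower_diagonal`** — `∃ α₀ γ′ > 0` (closed forms in `(d, a, L, M_φ, M_φ′, C_R, r)`) BEFORE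
  `∀ n ∀ η (ηL^{n+1} = 1) ∀ c₀ c₁ (c₀(L^{n+1})^d = c₁) ∀ m ∀ U … ∀ α ≤ α₀`: the same conclusion.  Free of the number of levels, the spacing, the
  volume; depends on the block size `L` (through `Ξ`) as print's constants do.
MODEL ∕ DECLARED READINGS.  (M1) the diagonal = print's `k`-th-step normalisation (p. 393); (M2) the bond-smallness profile `ε_j ≤ αr^j` of the
level averages `Ū^j` and the finest-level `‖U(b) − 1‖ ≤ αη` are DISPLAYED (print's running small-field axioms (1.11)–(1.14) of [I]; deriving them
from plaquette smallness is the gauge question, [B9] Lemma 3.1 ∕ (3.37)); the per-level regularity profile `α_j ≤ 1∕64` is E162's display (a theorem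
from (52): `B9Eq315QTowerRegularityProfile`); (M3) the `k`-level `R`-letter `C_R` DISPLAYED; (M4) `hRS` displayed (unitary backgrounds:
`B9Eq310HessianHermitian.adTransportW_adjoint`).  NOT HERE: `C_R` (ROUTE G one storey up), decay, infinite volume.
HONEST SCOPE.  [folklore] composition of landed letters + threshold arithmetic; «NE9 ⇐ the named binders»; NE9 NOT PRINTED ∕ NOT PROVED; NOT summit
progress (cell pub-balaban: row NE9 WALLED ON A MODEL; spine PROVED 0/9; rung (B)+1 finite T⁴ — NOT infinite volume, NOT mass gap, NOT Clay; HONEST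
DEPENDENCY: continuum YM on T⁴ ⇐ BetaPertH ∧ nine spine estimates (0/9 proved); BetaPertH ⇐ (D1) ∧ (D4) ∧ CAP+tail; G-an2-4 gates asym, D1 and
NE2/3/4).  NEW file importing `B9Thm311SmallFieldCoercivityTowerScaled`, `B9Eq315QTowerLipschitzL2`, `B9Eq315QTowerFlatNorm`, `B9Eq384RemainderLetters`;
modifies nothing.  Net new unproved facts: 0.
-/

noncomputable section

open scoped InnerProductSpace ComplexConjugate BigOperators

namespace Literature.MathematicalPhysics.QuantumFieldTheory.Balaban1983to89.B9Thm311SmallFieldCoercivityTowerDiagonal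

open B4Sect5Torus (TSite)
open B9SectCLatticeCarrier (Bond)
open B9Eq319QprimeTorus (fineP)
open B11Eq103H1Complex (SiteL2K BondL2K covDivL2K laplaceALatticeK)
open B9Eq310HessianOperator (adTransportW principalOpK covCurlL2K)
open B9Eq315QTorus (perCfg cornerSite)
open B9Eq315QTower (towerP UlevOf)
open B9Eq315QTowerFlat (perCfg_UlevOf_one_mem_U1 norm_Wcx_UlevOf_one_sub_one_le)
open B9Eq326OperatorTower (QkW RofUk)
open B7Prop1Explicit (U1 Wcx boxVec)
open B9Thm311SmallFieldCoercivityTowerScaled (strong_coercive_of_scaled_letters_tower)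
open B9Eq315QTowerLipschitzL2 (norm_QkW_sub_flat_le_L2_geometric)
open B9Eq315QTowerFlatNorm (norm_QkW_one_le_canonical)
open B9Eq384RemainderLetters (norm_adTransportW_sub_le)

/-! ## §1 Arithmetic -/

/-- `e^y − 1 ≤ 2y` for `0 ≤ y ≤ 1` (Mathlib's `Real.abs_exp_sub_one_le`). [folklore] -/
private theorem exp_sub_one_le_two_mul {y : ℝ} (hy0 : 0 ≤ y) (hy1 : y ≤ 1) : Real.exp y - 1 ≤ 2 * y := by
  have h := Real.abs_exp_sub_one_le (x := y) (by rw [abs_of_nonneg hy0]; exact hy1)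
  rw [abs_of_nonneg hy0] at h
  exact (le_abs_self _).trans h

/-- On the diagonal `c₀(L^{n+1})^d = c₁` the weighted-reading prefactor is `√(c₁∕(c₀(L^{n+1})^d)) = 1`. [cite: Balaban1985BackgroundPropagators, (3.16) p.393] -/
private theorem sqrt_ratio_diagonal {d L n : ℕ} {c₀ c₁ : ℝ} (hc₁ : 0 < c₁) (hw : c₀ * ((L : ℝ) ^ (n + 1)) ^ d = c₁) :
    Real.sqrt (c₁ / (c₀ * ((L : ℝ) ^ (n + 1)) ^ d)) = 1 := by
  rw [hw, div_self hc₁.ne', Real.sqrt_one]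

/-! ## §2 One lattice height, on the diagonal: `K_R`, `M_Q`, `C_Q` discharged -/

section One

variable {d : ℕ} (L : ℕ) [NeZero L] (m : Fin d → ℕ) [∀ i, NeZero (m i)] (n : ℕ) (hL : 1 ≤ L) {c₀ c₁ : ℝ} [Fact (0 < c₀)] [Fact (0 < c₁)]
  {𝔸 : Type*} [NormedRing 𝔸] [NormedAlgebra ℂ 𝔸] [CompleteSpace 𝔸] [NormOneClass 𝔸]
  {W : Type*} [NormedAddCommGroup W] [InnerProductSpace ℂ W] [FiniteDimensional ℂ W] (φ : W ≃ₗ[ℂ] 𝔸)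
  {Mφ Mφ' : ℝ} (hMφ : 0 ≤ Mφ) (hMφ' : 0 ≤ Mφ') (hφ : ∀ w, ‖φ w‖ ≤ Mφ * ‖w‖) (hφ' : ∀ X, ‖φ.symm X‖ ≤ Mφ' * ‖X‖)
  {η : ℝ} {a : ℝ} (ha : 0 < a) (U : Bond d (towerP L m (n + 1)) → 𝔸ˣ) (αU : ℕ → ℝ) (hα1 : ∀ j, αU j ≤ 1 / 64)
  (hU1 : ∀ (j : ℕ) (x : B7Prop1Explicit.Site d) (κ : Fin d), perCfg (towerP L m (j + 1)) (UlevOf L m (n + 1) U j) x κ ∈ U1 𝔸)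
  (hreg : ∀ (j : ℕ) (y : TSite d (towerP L m j)) (κ : Fin d) (r : Fin d → Fin L),
    ‖((Wcx L (perCfg (towerP L m (j + 1)) (UlevOf L m (n + 1) U j)) (cornerSite L y) κ (boxVec L r) : 𝔸ˣ) : 𝔸) - 1‖ ≤ αU j)
  (εU : ℕ → ℝ) (hεU : ∀ j, 0 ≤ εU j) (hUε : ∀ (j : ℕ) (b : Bond d (towerP L m (j + 1))), ‖(UlevOf L m (n + 1) U j b : 𝔸) - 1‖ ≤ εU j)
  (hRS : ∀ (b : Bond d (towerP L m (n + 1))) (v u : W), ⟪adTransportW φ U b v, u⟫_ℂ = ⟪v, adTransportW φ (fun b => (U b)⁻¹) b u⟫_ℂ)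
  {CR α r : ℝ} (hCR : 0 ≤ CR) (hα : 0 ≤ α) (hr0 : 0 ≤ r) (hr1 : r < 1)
  (hUb : ∀ b, U b ∈ U1 𝔸) (hUη : ∀ b, ‖(U b : 𝔸) - 1‖ ≤ α * η) (hεg : ∀ j < n + 1, εU j ≤ α * r ^ j)
  (hR : ∀ y : SiteL2K ℂ d (towerP L m (n + 1)) c₀ W, ‖RofUk L m n φ η U y - RofUk L m n φ η (fun _ : Bond d (towerP L m (n + 1)) => (1 : 𝔸ˣ)) y‖ ≤ CR * α * ‖y‖)

include hMφ hMφ' hφ hφ' ha hεU hUε hRS hCR hα hr0 hr1 hUb hUη hεg hR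

/-- **THE `k`-LEVEL STRONG SMALL-FIELD COERCIVITY ON PRINT's DIAGONAL, MODULO THE `R`-LETTER ALONE** (one lattice height): at `ηL^{n+1} = 1`,
`c₀(L^{n+1})^d = c₁`, for a background with unit-bounded `αη`-small bond variables, mutually adjoint transporters, E162's per-level averaging data and
the geometric bond-smallness profile `ε_j ≤ αr^j` of the level averages, the `R`-letter `C_R·α` DISPLAYED, and
`α ≤ 1`, `Ξα ≤ 1 − r`, `α ≤ γ(d,a)∕(2Θ♯ + 1)` with `Ξ = √(L^d)·√(2d)·102(d+1)²L`, `Θ♯ = Θ(K_R := 2M_φM_φ′, C_R, C_Q := 2M_φ′M_φΞ∕(1−r), M_Q := M_φ′M_φ)`: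
`(γ(d,a)∕2)·(‖D(1)x‖² + ‖D*(1)x‖² + ‖x‖²) ≤ re⟨x, Δ^{(n+1)}_a(U)x⟩` — `…TowerScaled.strong_coercive_of_scaled_letters_tower` with the three letters
inhabited by `norm_adTransportW_sub_le`, `norm_QkW_sub_flat_le_L2_geometric` (`√(c₁∕(c₀L^{kd})) = 1`, `e^y − 1 ≤ 2y`), `norm_QkW_one_le_canonical`.
[cite: Balaban1985BackgroundPropagators, Thm 3.11 p.416, (3.16) p.393, (3.35) p.396, (3.82)–(3.86) p.407; Balaban1984PropagatorsI, Prop. 1.1 (1.90) p.33] -/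
theorem strong_coercive_tower_diagonal (hηL : η * (L : ℝ) ^ (n + 1) = 1) (hw : c₀ * ((L : ℝ) ^ (n + 1)) ^ d = c₁) (hα1' : α ≤ 1)
    (hαΞ : Real.sqrt ((L : ℝ) ^ d) * (Real.sqrt (2 * d) * (102 * (d + 1) ^ 2 * L)) * α ≤ 1 - r)
    (hαΘ : α ≤ (1 / ((d + 1 : ℝ) * B5Prop11Plancherel.Cst d a)) /
      (2 * (5 * Real.sqrt d * (2 * Mφ * Mφ') + 17 * d * (2 * Mφ * Mφ') ^ 2 + Real.sqrt d * (2 * Mφ * Mφ') * CR + 2 * CR + CR ^ 2 +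
        a * (2 * (Mφ' * Mφ) * (Real.sqrt ((L : ℝ) ^ d) * (Real.sqrt (2 * d) * (102 * (d + 1) ^ 2 * L))) / (1 - r)) *
          (2 * (Mφ' * Mφ) + 2 * (Mφ' * Mφ) * (Real.sqrt ((L : ℝ) ^ d) * (Real.sqrt (2 * d) * (102 * (d + 1) ^ 2 * L))) / (1 - r))) + 1))
    (x : BondL2K ℂ d (towerP L m (n + 1)) c₀ W) :
    (1 / ((d + 1 : ℝ) * B5Prop11Plancherel.Cst d a)) / 2 *
        (‖covCurlL2K ℂ c₀ ((η : ℂ))⁻¹ (adTransportW φ (fun _ : Bond d (towerP L m (n + 1)) => (1 : 𝔸ˣ))) x‖ ^ 2 +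
          ‖covDivL2K ℂ c₀ ((η : ℂ))⁻¹ (adTransportW φ fun _ : Bond d (towerP L m (n + 1)) => (1 : 𝔸ˣ)⁻¹) x‖ ^ 2 + ‖x‖ ^ 2) ≤
      RCLike.re ⟪x, laplaceALatticeK ((η : ℂ))⁻¹ (adTransportW φ U) (adTransportW φ fun b => (U b)⁻¹) (principalOpK φ η U) (RofUk L m n φ η U)
        (QkW L m n φ U hL αU hα1 hU1 hreg (c₁ := c₁)) a x⟫_ℂ := by
  have hc₁ : 0 < c₁ := Fact.out
  have hL0 : (0 : ℝ) < L := by exact_mod_cast Nat.pos_of_ne_zero (NeZero.ne L)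
  have hLr : (0 : ℝ) < (L : ℝ) ^ (n + 1) := by positivity
  have hηL0 : 0 < η * (L : ℝ) ^ (n + 1) := by rw [hηL]; exact one_pos
  have hη : 0 < η := pos_of_mul_pos_left hηL0 hLr.le
  have hs : c₁ * (η * (L : ℝ) ^ (n + 1)) ^ 2 = c₀ * ((L : ℝ) ^ (n + 1)) ^ d := by rw [hηL, one_pow, mul_one, hw]
  set Ξ : ℝ := Real.sqrt ((L : ℝ) ^ d) * (Real.sqrt (2 * d) * (102 * (d + 1) ^ 2 * L)) with hΞ
  have hΞ0 : 0 ≤ Ξ := by rw [hΞ]; positivity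
  have h1r : 0 < 1 - r := by linarith
  -- the three letters
  have hRε : ∀ (b : Bond d (towerP L m (n + 1))) (w : W), ‖adTransportW φ U b w - w‖ ≤ 2 * Mφ * Mφ' * α * η * ‖w‖ := fun b w => by
    have h := norm_adTransportW_sub_le φ hφ hφ' hMφ' U b (hUb b) (hUη b) w
    linarith [h]
  have hQ₁ : ∀ y : BondL2K ℂ d (towerP L m (n + 1)) c₀ W,
      ‖QkW L m n φ (fun _ : Bond d (towerP L m (n + 1)) => (1 : 𝔸ˣ)) hL (fun _ => 0) (fun _ => by norm_num)
          (perCfg_UlevOf_one_mem_U1 L m (n + 1)) (norm_Wcx_UlevOf_one_sub_one_le L m (n + 1) (fun _ => 0) (fun _ => le_rfl)) (c₀ := c₀)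
          (c₁ := c₁) y‖ ≤ Mφ' * Mφ * ‖y‖ := fun y => by
    have h := norm_QkW_one_le_canonical L m n hL φ hMφ hφ hMφ' hφ' (fun _ => 0) (fun _ => by norm_num)
      (perCfg_UlevOf_one_mem_U1 L m (n + 1)) (norm_Wcx_UlevOf_one_sub_one_le L m (n + 1) (fun _ => 0) (fun _ => le_rfl)) (c₀ := c₀)
      (c₁ := c₁) hηL0 hs y
    rwa [hηL, inv_one, mul_one] at h
  have hy1 : Ξ * (α / (1 - r)) ≤ 1 := by
    rw [← mul_div_assoc, div_le_one h1r, hΞ]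
    exact hαΞ
  have hy0 : 0 ≤ Ξ * (α / (1 - r)) := by positivity
  have hQ : ∀ y : BondL2K ℂ d (towerP L m (n + 1)) c₀ W, ‖QkW L m n φ U hL αU hα1 hU1 hreg (c₀ := c₀) (c₁ := c₁) y -
      QkW L m n φ (fun _ : Bond d (towerP L m (n + 1)) => (1 : 𝔸ˣ)) hL (fun _ => 0) (fun _ => by norm_num)
        (perCfg_UlevOf_one_mem_U1 L m (n + 1)) (norm_Wcx_UlevOf_one_sub_one_le L m (n + 1) (fun _ => 0) (fun _ => le_rfl)) (c₀ := c₀)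
        (c₁ := c₁) y‖ ≤ 2 * (Mφ' * Mφ) * Ξ / (1 - r) * α * ‖y‖ := fun y => by
    have h := norm_QkW_sub_flat_le_L2_geometric L m n hL φ hMφ hMφ' hφ hφ' (c₀ := c₀) (c₁ := c₁) U αU hα1 hU1 hreg εU hεU hUε hr0 hr1 hα
      hεg y
    rw [sqrt_ratio_diagonal hc₁ hw, mul_one, ← hΞ] at h
    have he : Real.exp (Ξ * (α / (1 - r))) - 1 ≤ 2 * (Ξ * (α / (1 - r))) := exp_sub_one_le_two_mul hy0 hy1
    have h2 : Mφ' * Mφ * (Real.exp (Ξ * (α / (1 - r))) - 1) * ‖y‖ ≤ Mφ' * Mφ * (2 * (Ξ * (α / (1 - r)))) * ‖y‖ :=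
      mul_le_mul_of_nonneg_right (mul_le_mul_of_nonneg_left he (by positivity)) (norm_nonneg _)
    refine h.trans (h2.trans (le_of_eq ?_))
    field_simp
  -- the scaled theorem with `K_R := 2M_φM_φ′`, `C_Q := 2M_φ′M_φΞ∕(1−r)`, `M_Q := M_φ′M_φ`
  have key := strong_coercive_of_scaled_letters_tower L m n hL φ (c₀ := c₀) (c₁ := c₁) ha U αU hα1 hU1 hreg hRS
    (by positivity : (0 : ℝ) ≤ 2 * Mφ * Mφ') hCR (by positivity : (0 : ℝ) ≤ 2 * (Mφ' * Mφ) * Ξ / (1 - r)) (by positivity : (0 : ℝ) ≤ Mφ' * Mφ)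
    hα (fun b w => by rw [show 2 * Mφ * Mφ' * α * η * ‖w‖ = 2 * Mφ * Mφ' * α * η * ‖w‖ from rfl]; exact hRε b w) hR
    (fun y => by rw [show 2 * (Mφ' * Mφ) * Ξ / (1 - r) * α * ‖y‖ = 2 * (Mφ' * Mφ) * Ξ / (1 - r) * α * ‖y‖ from rfl]; exact hQ y) hQ₁ hηL0
    (le_of_eq hηL) hs hα1' (by rw [hΞ]; exact hαΘ) x
  exact key

end One

/-! ## §3 `∃ α₀ γ′` BEFORE `∀ n ∀ η ∀ c₀ c₁ ∀ m ∀ U ∀ α` on the diagonal — modulo `C_R` alone -/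

section Exists

variable {d : ℕ} (L : ℕ) [NeZero L] (hL : 1 ≤ L) {𝔸 : Type*} [NormedRing 𝔸] [NormedAlgebra ℂ 𝔸] [CompleteSpace 𝔸] [NormOneClass 𝔸]
  {W : Type*} [NormedAddCommGroup W] [InnerProductSpace ℂ W] [FiniteDimensional ℂ W] (φ : W ≃ₗ[ℂ] 𝔸)
  {Mφ Mφ' : ℝ} (hMφ : 0 ≤ Mφ) (hMφ' : 0 ≤ Mφ') (hφ : ∀ w, ‖φ w‖ ≤ Mφ * ‖w‖) (hφ' : ∀ X, ‖φ.symm X‖ ≤ Mφ' * ‖X‖)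
  {a : ℝ} (ha : 0 < a) {CR r : ℝ} (hCR : 0 ≤ CR) (hr0 : 0 ≤ r) (hr1 : r < 1)

include hMφ hMφ' hφ hφ' ha hCR hr0 hr1

/-- **[B9] THM 3.11's SECOND HALF AT `k = n+1` LEVELS ON PRINT's DIAGONAL, STRONG, MODULO THE `k`-LEVEL `R`-LETTER `C_R` ALONE** — for the block size
`L`, the fibre letters `M_φ, M_φ′`, `a > 0`, `C_R ≥ 0` and a profile ratio `0 ≤ r < 1` THERE ARE `α₀, γ′ > 0` — the closed forms
`α₀ = min(min 1 ((1−r)∕(Ξ(d,L)+1)), γ(d,a)∕(2Θ♯+1))`, `γ′ = γ(d,a)∕2` — such that for EVERY number of levels `n`, spacing `η` with `ηL^{n+1} = 1`,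
weights `c₀(L^{n+1})^d = c₁`, volume `m`, background `U` (E162's per-level data, mutually adjoint transporters, unit-bounded `αη`-small bonds, level
bond-smallness profile `ε_j ≤ αr^j`) and `0 ≤ α ≤ α₀` with `‖(R_k(U) − R_k(1))y‖ ≤ C_Rα‖y‖`:
`γ′·(‖D(1)x‖² + ‖D*(1)x‖² + ‖x‖²) ≤ re⟨x, Δ^{(n+1)}_a(U)x⟩`.  No `n`, `η`, `m`, `c₀`, `c₁` in `α₀` or `γ′`.
[cite: Balaban1985BackgroundPropagators, Thm 3.11 p.416, (3.16) p.393, (3.35) p.396, (3.82)–(3.86) p.407; Balaban1984PropagatorsI, Prop. 1.1 (1.90) p.33] -/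
theorem exists_strong_coercive_tower_diagonal :
    ∃ α₀ γ' : ℝ, 0 < α₀ ∧ 0 < γ' ∧ ∀ (n : ℕ) (η : ℝ), η * (L : ℝ) ^ (n + 1) = 1 →
      ∀ (c₀ c₁ : ℝ) [Fact (0 < c₀)] [Fact (0 < c₁)], c₀ * ((L : ℝ) ^ (n + 1)) ^ d = c₁ →
      ∀ (m : Fin d → ℕ) [∀ i, NeZero (m i)] (U : Bond d (towerP L m (n + 1)) → 𝔸ˣ) (αU : ℕ → ℝ) (hα1 : ∀ j, αU j ≤ 1 / 64)
        (hU1 : ∀ (j : ℕ) (x : B7Prop1Explicit.Site d) (κ : Fin d), perCfg (towerP L m (j + 1)) (UlevOf L m (n + 1) U j) x κ ∈ U1 𝔸)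
        (hreg : ∀ (j : ℕ) (y : TSite d (towerP L m j)) (κ : Fin d) (r : Fin d → Fin L),
          ‖((Wcx L (perCfg (towerP L m (j + 1)) (UlevOf L m (n + 1) U j)) (cornerSite L y) κ (boxVec L r) : 𝔸ˣ) : 𝔸) - 1‖ ≤ αU j)
        (εU : ℕ → ℝ), (∀ j, 0 ≤ εU j) → (∀ (j : ℕ) (b : Bond d (towerP L m (j + 1))), ‖(UlevOf L m (n + 1) U j b : 𝔸) - 1‖ ≤ εU j) →
      ∀ {α : ℝ}, 0 ≤ α → α ≤ α₀ →
        (∀ (b : Bond d (towerP L m (n + 1))) (v u : W), ⟪adTransportW φ U b v, u⟫_ℂ = ⟪v, adTransportW φ (fun b => (U b)⁻¹) b u⟫_ℂ) →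
        (∀ b, U b ∈ U1 𝔸) → (∀ b, ‖(U b : 𝔸) - 1‖ ≤ α * η) → (∀ j < n + 1, εU j ≤ α * r ^ j) →
        (∀ y : SiteL2K ℂ d (towerP L m (n + 1)) c₀ W,
          ‖RofUk L m n φ η U y - RofUk L m n φ η (fun _ : Bond d (towerP L m (n + 1)) => (1 : 𝔸ˣ)) y‖ ≤ CR * α * ‖y‖) →
        ∀ x : BondL2K ℂ d (towerP L m (n + 1)) c₀ W,
          γ' * (‖covCurlL2K ℂ c₀ ((η : ℂ))⁻¹ (adTransportW φ (fun _ : Bond d (towerP L m (n + 1)) => (1 : 𝔸ˣ))) x‖ ^ 2 +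
              ‖covDivL2K ℂ c₀ ((η : ℂ))⁻¹ (adTransportW φ fun _ : Bond d (towerP L m (n + 1)) => (1 : 𝔸ˣ)⁻¹) x‖ ^ 2 + ‖x‖ ^ 2) ≤
            RCLike.re ⟪x, laplaceALatticeK ((η : ℂ))⁻¹ (adTransportW φ U) (adTransportW φ fun b => (U b)⁻¹) (principalOpK φ η U)
              (RofUk L m n φ η U) (QkW L m n φ U hL αU hα1 hU1 hreg (c₁ := c₁)) a x⟫_ℂ := by
  have hC : (1 : ℝ) ≤ B5Prop11Plancherel.Cst d a := B5Prop11Lower.one_le_Cst _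
  have hL0 : (0 : ℝ) < L := by exact_mod_cast Nat.pos_of_ne_zero (NeZero.ne L)
  set Ξ : ℝ := Real.sqrt ((L : ℝ) ^ d) * (Real.sqrt (2 * d) * (102 * (d + 1) ^ 2 * L)) with hΞ
  have hΞ0 : 0 ≤ Ξ := by rw [hΞ]; positivity
  have h1r : 0 < 1 - r := by linarith
  set Θ : ℝ := 5 * Real.sqrt d * (2 * Mφ * Mφ') + 17 * d * (2 * Mφ * Mφ') ^ 2 + Real.sqrt d * (2 * Mφ * Mφ') * CR + 2 * CR + CR ^ 2 +
    a * (2 * (Mφ' * Mφ) * Ξ / (1 - r)) * (2 * (Mφ' * Mφ) + 2 * (Mφ' * Mφ) * Ξ / (1 - r)) with hΘ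
  have hΘ0 : 0 ≤ Θ := by rw [hΘ]; positivity
  refine ⟨min (min 1 ((1 - r) / (Ξ + 1))) ((1 / ((d + 1 : ℝ) * B5Prop11Plancherel.Cst d a)) / (2 * Θ + 1)),
    (1 / ((d + 1 : ℝ) * B5Prop11Plancherel.Cst d a)) / 2, lt_min (lt_min one_pos (by positivity)) (by positivity), by positivity, ?_⟩
  intro n η hηL c₀ c₁ _ _ hw m _ U αU hα1 hU1 hreg εU hεU hUε α hα0 hαle hRS hUb hUη hεg hR x
  have hα1' : α ≤ 1 := hαle.trans ((min_le_left _ _).trans (min_le_left _ _))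
  have hαΞ' : α ≤ (1 - r) / (Ξ + 1) := hαle.trans ((min_le_left _ _).trans (min_le_right _ _))
  have hαΞ : Ξ * α ≤ 1 - r := by
    have h1 : Ξ * α ≤ Ξ * ((1 - r) / (Ξ + 1)) := mul_le_mul_of_nonneg_left hαΞ' hΞ0
    have h2 : Ξ * ((1 - r) / (Ξ + 1)) ≤ 1 - r := by
      rw [mul_div_assoc', div_le_iff₀ (by positivity)]
      nlinarith
    exact h1.trans h2
  have hαΘ : α ≤ (1 / ((d + 1 : ℝ) * B5Prop11Plancherel.Cst d a)) / (2 * Θ + 1) := hαle.trans (min_le_right _ _)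
  exact strong_coercive_tower_diagonal L m n hL φ hMφ hMφ' hφ hφ' ha U αU hα1 hU1 hreg εU hεU hUε hRS hCR hα0 hr0 hr1 hUb hUη hεg hR hηL hw
    hα1' (by rw [hΞ] at hαΞ; exact hαΞ) (by rw [hΘ, hΞ] at hαΘ; exact hαΘ) x

end Exists

end Literature.MathematicalPhysics.QuantumFieldTheory.Balaban1983to89.B9Thm311SmallFieldCoercivityTowerDiagonal

end
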